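import Summits.CriticalPhenomena.CardyFormulaZ2.Theorems.CardyBoundaryCoulombGasRectilinearCardyStubRowBlocksPart1
import HarnessLib

/-!
# Stub B `stub_rowBlocks` of line `excursion-kernel-covariance`, part 2: lattice corners and the
# bookkeeping of one boundary cycle
# (crux `RectilinearCardy`, stmt-CriticalPhenomena-5660, route `CardyBoundaryCoulombGas`)

Geometry-free facts about the counter-clockwise boundary walk `dsucc` of a finite `V ⊂ ℤ²`:

* `rb_no_neck` — under a half-plane / convex / reflex lattice chart of range `3` at a boundary
  vertex `u` (the CHART regularity of the engine line, `ec_chart_of_small`), no two OPPOSITE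
  neighbours of `u` are both outside `V`;
* `rb_card_filter_dir` — the neighbour count `#{y ~ u : y ∉ V}` counts outside DIRECTIONS;
  `rb_convex_of_card_two` — a vertex with two outside neighbours and no neck is a lattice convex
  corner: outside along `k, k + 1`, inside along `k + 2, k + 3`;
* `rb_corner_consecutive` — on a `dsucc`-sequence the two exterior darts of such a corner are
  CONSECUTIVE (the turn `dsucc V (u, k) = (u, k + 1)` and injectivity of `dsucc`);
* bookkeeping of a periodic enumeration `e` of the exterior darts (`e (n + 1) = dsucc V (e n)`,
  period `P`, no repetition below `P`): reduction of indices mod `P` (`rb_periodic_mod`), iterates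
  (`rb_iterate_eq`), the intrinsic period `period V (e 0) = P` (`rb_period_eq`), shifting the origin
  (`rb_shift_nodup`, `rb_shift_enum`), and "a vertex with one outside neighbour carries one dart"
  (`rb_index_unique`).

All [folklore].
-/

noncomputable section

open Set Metric
open Literature.Probability.LatticeModels (Site meshPoint Orient)
open Literature.Probability.LatticeModels.CollarLegModel (Dart dartTip dir dsucc outDart period neighbours)
open Summit.CriticalPhenomena.CardyFormulaZ2.Cruxes.BoundaryDefectGaussianR.RainbowMonomialsInExcursionKernels
  (s3_outDart_of_card s3_dsucc_injective s3_period_spec tp_dir_val tp_dir_add_two)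

namespace Summit.CriticalPhenomena.CardyFormulaZ2.Cruxes.RectilinearCardy.ExcursionKernelCovariance

/-! ### No necks under a lattice chart -/

/-- Scalar products with a direction are additive in the lattice point. [folklore] -/
theorem rb_dot_add (v w d : ℤ × ℤ) :
    (v + w).1 * d.1 + (v + w).2 * d.2 = (v.1 * d.1 + v.2 * d.2) + (w.1 * d.1 + w.2 * d.2) := by
  simp only [Prod.fst_add, Prod.snd_add]; ring

/-- A lattice direction is orthogonal to one of two consecutive directions. [folklore] -/
theorem rb_dot_dir_zero_or (j K : Fin 4) :
    (dir j).1 * (dir K).1 + (dir j).2 * (dir K).2 = 0 ∨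
      (dir j).1 * (dir (K + 1)).1 + (dir j).2 * (dir (K + 1)).2 = 0 := by
  revert j K; decide

/-- Lattice steps are short: `|dir k| ≤ 3` coordinatewise around `u`. [folklore] -/
theorem rb_dir_box (u : ℤ × ℤ) (k : Fin 4) : |(u + dir k).1 - u.1| ≤ 3 ∧ |(u + dir k).2 - u.2| ≤ 3 := by
  obtain ⟨h0, h1, h2, h3⟩ := tp_dir_val
  fin_cases k <;> simp [h0, h1, h2, h3]

/-- **No necks.** If `V` has a half-plane, convex or reflex lattice chart of range `3` at `u ∈ V`,
then no two opposite neighbours `u + dir j`, `u + dir (j + 2)` are both outside `V`. [folklore] -/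
theorem rb_no_neck {V : Finset (ℤ × ℤ)} {u : ℤ × ℤ} (hu : u ∈ V) {K : Fin 4} {c₁ c₂ : ℤ}
    (hchart : (∀ v : ℤ × ℤ, |v.1 - u.1| ≤ 3 → |v.2 - u.2| ≤ 3 →
        (v ∈ V ↔ c₂ ≤ v.1 * (dir (K + 1)).1 + v.2 * (dir (K + 1)).2)) ∨
      (∀ v : ℤ × ℤ, |v.1 - u.1| ≤ 3 → |v.2 - u.2| ≤ 3 →
        (v ∈ V ↔ c₁ ≤ v.1 * (dir K).1 + v.2 * (dir K).2 ∧
          c₂ ≤ v.1 * (dir (K + 1)).1 + v.2 * (dir (K + 1)).2)) ∨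
      (∀ v : ℤ × ℤ, |v.1 - u.1| ≤ 3 → |v.2 - u.2| ≤ 3 →
        (v ∈ V ↔ c₂ ≤ v.1 * (dir (K + 1)).1 + v.2 * (dir (K + 1)).2 ∨
          v.1 * (dir K).1 + v.2 * (dir K).2 ≤ c₁)))
    (j : Fin 4) : ¬ (u + dir j ∉ V ∧ u + dir (j + 2) ∉ V) := by
  rintro ⟨hj, hj2⟩
  have hu0 : |u.1 - u.1| ≤ 3 ∧ |u.2 - u.2| ≤ 3 := by simp
  obtain ⟨hb1, hb2⟩ := rb_dir_box u j
  obtain ⟨hb1', hb2'⟩ := rb_dir_box u (j + 2)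
  have hneg : dir (j + 2) = -dir j := tp_dir_add_two j
  -- scalar products of the steps
  have e1 : ∀ d : ℤ × ℤ, (u + dir j).1 * d.1 + (u + dir j).2 * d.2 =
      (u.1 * d.1 + u.2 * d.2) + ((dir j).1 * d.1 + (dir j).2 * d.2) := fun d => rb_dot_add u (dir j) d
  have e2 : ∀ d : ℤ × ℤ, (u + dir (j + 2)).1 * d.1 + (u + dir (j + 2)).2 * d.2 =
      (u.1 * d.1 + u.2 * d.2) - ((dir j).1 * d.1 + (dir j).2 * d.2) := fun d => by
    rw [rb_dot_add, hneg]; simp only [Prod.fst_neg, Prod.snd_neg]; ring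
  have horth := rb_dot_dir_zero_or j K
  rcases hchart with h | h | h
  · have h0 := (h u hu0.1 hu0.2).1 hu
    have h1 := mt (h _ hb1 hb2).2 hj
    have h2 := mt (h _ hb1' hb2').2 hj2
    rw [e1] at h1; rw [e2] at h2
    omega
  · have h0 := (h u hu0.1 hu0.2).1 hu
    have h1 := mt (h _ hb1 hb2).2 hj
    have h2 := mt (h _ hb1' hb2').2 hj2
    rw [e1, e1] at h1; rw [e2, e2] at h2
    omega
  · have h0 := (h u hu0.1 hu0.2).1 hu
    have h1 := mt (h _ hb1 hb2).2 hj
    have h2 := mt (h _ hb1' hb2').2 hj2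
    rw [e1, e1] at h1; rw [e2, e2] at h2
    omega

/-! ### Neighbour counts and lattice convex corners -/

/-- The neighbour count counts outside directions. [folklore] -/
theorem rb_card_filter_dir (V : Finset (ℤ × ℤ)) (u : ℤ × ℤ) :
    ((neighbours u).filter (fun y ↦ y ∉ V)).card =
      ((Finset.univ : Finset (Fin 4)).filter (fun j ↦ u + dir j ∉ V)).card := by
  have hdinj : ∀ j j' : Fin 4, dir j = dir j' → j = j' := by decide
  have hinj : Function.Injective fun j : Fin 4 => u + dir j := fun j j' h =>
    hdinj j j' (add_left_cancel h)
  rw [← Finset.card_image_of_injective ((Finset.univ : Finset (Fin 4)).filter (fun j ↦ u + dir j ∉ V)) hinj]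
  congr 1
  ext y
  simp only [Finset.mem_filter, Finset.mem_image, Finset.mem_univ, true_and, rb_mem_neighbours_iff]
  constructor
  · rintro ⟨⟨j, rfl⟩, hy⟩
    exact ⟨j, hy, rfl⟩
  · rintro ⟨j, hj, rfl⟩
    exact ⟨⟨j, rfl⟩, hj⟩

/-- **A vertex with two outside neighbours and no neck is a lattice convex corner**: outside along
two consecutive directions `k, k + 1`, inside along `k + 2, k + 3`. [folklore] -/
theorem rb_convex_of_card_two {V : Finset (ℤ × ℤ)} {u : ℤ × ℤ}
    (hcard : ((neighbours u).filter (fun y ↦ y ∉ V)).card = 2)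
    (hneck : ∀ j : Fin 4, ¬ (u + dir j ∉ V ∧ u + dir (j + 2) ∉ V)) :
    ∃ k : Fin 4, u + dir k ∉ V ∧ u + dir (k + 1) ∉ V ∧ u + dir (k + 2) ∈ V ∧ u + dir (k + 3) ∈ V := by
  classical
  rw [rb_card_filter_dir] at hcard
  obtain ⟨a, b, hab, hS⟩ := Finset.card_eq_two.1 hcard
  have hmem : ∀ j : Fin 4, u + dir j ∉ V ↔ j = a ∨ j = b := by
    intro j
    have := Finset.ext_iff.1 hS j
    simpa using this
  have ha : u + dir a ∉ V := (hmem a).2 (Or.inl rfl)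
  have hb : u + dir b ∉ V := (hmem b).2 (Or.inr rfl)
  have hb2 : b ≠ a + 2 := fun h => hneck a ⟨ha, h ▸ hb⟩
  have hin : ∀ j : Fin 4, j ≠ a → j ≠ b → u + dir j ∈ V := fun j h1 h2 => by
    by_contra h
    rcases (hmem j).1 h with h' | h' <;> contradiction
  have hF : ∀ a b : Fin 4, a ≠ b → b ≠ a + 2 →
      (b = a + 1 ∧ a + 2 ≠ a ∧ a + 2 ≠ b ∧ a + 3 ≠ a ∧ a + 3 ≠ b) ∨
      (a = b + 1 ∧ b + 2 ≠ a ∧ b + 2 ≠ b ∧ b + 3 ≠ a ∧ b + 3 ≠ b) := by decide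
  rcases hF a b hab hb2 with ⟨h1, h2, h3, h4, h5⟩ | ⟨h1, h2, h3, h4, h5⟩
  · exact ⟨a, ha, h1 ▸ hb, hin _ h2 h3, hin _ h4 h5⟩
  · exact ⟨b, hb, h1 ▸ ha, hin _ h2 h3, hin _ h4 h5⟩

/-- A boundary vertex with at most two outside neighbours and neighbour count `≠ 1` has exactly two.
[folklore] -/
theorem rb_card_eq_two {V : Finset (ℤ × ℤ)} {u : ℤ × ℤ} {k : Fin 4} (hk : u + dir k ∉ V)
    (hle : ((neighbours u).filter (fun y ↦ y ∉ V)).card ≤ 2)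
    (hne : ((neighbours u).filter (fun y ↦ y ∉ V)).card ≠ 1) :
    ((neighbours u).filter (fun y ↦ y ∉ V)).card = 2 := by
  have hpos : 0 < ((neighbours u).filter (fun y ↦ y ∉ V)).card :=
    Finset.card_pos.2 ⟨u + dir k, Finset.mem_filter.2 ⟨rb_mem_neighbours_iff.2 ⟨k, rfl⟩, hk⟩⟩
  omega

/-! ### Corners on a boundary cycle -/

/-- Two consecutive non-opposite conditions pin a direction: `k' ∉ {k + 2, k + 3}` gives
`k' ∈ {k, k + 1}`. [folklore] -/
theorem rb_fin4_cases (k k' : Fin 4) (h2 : k' ≠ k + 2) (h3 : k' ≠ k + 3) : k' = k ∨ k' = k + 1 := by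
  revert k k'; decide

/-- **The two darts of a lattice convex corner are consecutive on the boundary walk.** Let `e` be a
`dsucc V`-sequence of exterior darts with period `P > 0`, and let the vertex `u = (e n).1` be outside
along `k, k + 1` and inside along `k + 2, k + 3`. Then either `e n = (u, k)` and `e (n + 1) = (u, k + 1)`,
or `e n = (u, k + 1)` and `e (n + P - 1) = (u, k)`. [folklore] -/
theorem rb_corner_consecutive {V : Finset (ℤ × ℤ)} {e : ℕ → Dart} {P : ℕ} (hP : 0 < P)
    (hsucc : ∀ n, e (n + 1) = dsucc V (e n)) (hper : ∀ n, e (n + P) = e n)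
    (hext : ∀ n, (e n).1 ∈ V ∧ dartTip (e n) ∉ V) {n : ℕ} {k : Fin 4}
    (hk : (e n).1 + dir k ∉ V) (hk1 : (e n).1 + dir (k + 1) ∉ V) (hk2 : (e n).1 + dir (k + 2) ∈ V)
    (hk3 : (e n).1 + dir (k + 3) ∈ V) :
    (e n = ((e n).1, k) ∧ e (n + 1) = ((e n).1, k + 1)) ∨
      (e n = ((e n).1, k + 1) ∧ e (n + P - 1) = ((e n).1, k)) := by
  have htip := (hext n).2
  simp only [dartTip] at htip
  have h2 : (e n).2 ≠ k + 2 := fun h => htip (h ▸ hk2)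
  have h3 : (e n).2 ≠ k + 3 := fun h => htip (h ▸ hk3)
  have hturn : dsucc V ((e n).1, k) = ((e n).1, k + 1) := (rb_dsucc_cases V (e n).1 k).1 hk1
  rcases rb_fin4_cases k (e n).2 h2 h3 with h | h
  · left
    have hen : e n = ((e n).1, k) := Prod.ext rfl h
    refine ⟨hen, ?_⟩
    rw [hsucc, hen, hturn]
  · right
    have hen : e n = ((e n).1, k + 1) := Prod.ext rfl h
    refine ⟨hen, ?_⟩
    have hidx : n + P - 1 + 1 = n + P := by omega
    have hd : dsucc V (e (n + P - 1)) = dsucc V ((e n).1, k) := by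
      rw [← hsucc, hidx, hper, hturn, ← hen]
    exact (s3_dsucc_injective V _ _ (hext _).1 (hext _).2 (hext n).1 hk hd)

/-! ### Bookkeeping of a periodic enumeration -/

/-- A `P`-periodic sequence only depends on the index mod `P`. [folklore] -/
theorem rb_periodic_mod {α : Type*} {e : ℕ → α} {P : ℕ} (hper : ∀ n, e (n + P) = e n) (n : ℕ) :
    e n = e (n % P) := by
  conv_lhs => rw [← Nat.mod_add_div n P]
  generalize n / P = q
  induction q with
  | zero => simp
  | succ q ih => rw [Nat.mul_succ, ← add_assoc, hper, ih]

/-- Iterates of the walk along a `dsucc`-sequence. [folklore] -/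
theorem rb_iterate_eq {V : Finset (ℤ × ℤ)} {e : ℕ → Dart} (hsucc : ∀ n, e (n + 1) = dsucc V (e n))
    (i n : ℕ) : (dsucc V)^[i] (e n) = e (n + i) := by
  induction i with
  | zero => simp
  | succ i ih => rw [Function.iterate_succ_apply', ih, ← hsucc, add_assoc]

/-- **The intrinsic period of the walk is the period of the enumeration**: for a `dsucc`-sequence of
exterior darts with period `P > 0` and no repetition below `P`, `period V (e 0) = P`. [folklore] -/
theorem rb_period_eq {V : Finset (ℤ × ℤ)} {e : ℕ → Dart} {P : ℕ} (hP : 0 < P)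
    (hsucc : ∀ n, e (n + 1) = dsucc V (e n)) (hper : ∀ n, e (n + P) = e n)
    (hext : ∀ n, (e n).1 ∈ V ∧ dartTip (e n) ∉ V)
    (hnodup : ∀ n m, n < P → m < P → e n = e m → n = m) : period V (e 0) = P := by
  obtain ⟨hpos, -, hret, hmin⟩ := s3_period_spec V (e 0) (hext 0).1 (hext 0).2
  have hret' : e (period V (e 0)) = e 0 := by
    have := hret
    rwa [rb_iterate_eq hsucc, zero_add] at this
  by_contra hne
  rcases lt_or_gt_of_ne hne with hlt | hgt
  · exact absurd (hnodup _ _ hlt hP hret') hpos.ne'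
  · refine hmin P hP hgt ?_
    rw [rb_iterate_eq hsucc, zero_add, ← zero_add P, hper]

/-- **Shifting the origin keeps "no repetition below the period"**. [folklore] -/
theorem rb_shift_nodup {α : Type*} {e : ℕ → α} {P : ℕ} (hper : ∀ n, e (n + P) = e n)
    (hnodup : ∀ n m, n < P → m < P → e n = e m → n = m) (n₀ : ℕ) :
    ∀ n m, n < P → m < P → e (n₀ + n) = e (n₀ + m) → n = m := by
  intro n m hn hm h
  have hP : 0 < P := by omega
  rw [rb_periodic_mod hper (n₀ + n), rb_periodic_mod hper (n₀ + m)] at h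
  have h1 : (n₀ + n) % P = (n₀ + m) % P := hnodup _ _ (Nat.mod_lt _ hP) (Nat.mod_lt _ hP) h
  have h2 : n % P = m % P := Nat.ModEq.add_left_cancel' n₀ h1
  rwa [Nat.mod_eq_of_lt hn, Nat.mod_eq_of_lt hm] at h2

/-- **Shifting the origin keeps "every exterior dart is enumerated below the period"**. [folklore] -/
theorem rb_shift_enum {V : Finset (ℤ × ℤ)} {e : ℕ → Dart} {P : ℕ} (hper : ∀ n, e (n + P) = e n)
    (henum : ∀ d : Dart, d.1 ∈ V → dartTip d ∉ V → ∃ n, n < P ∧ e n = d) (n₀ : ℕ) :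
    ∀ d : Dart, d.1 ∈ V → dartTip d ∉ V → ∃ n, n < P ∧ e (n₀ + n) = d := by
  intro d hd hdt
  obtain ⟨n, hn, rfl⟩ := henum d hd hdt
  have hP : 0 < P := by omega
  refine ⟨(n + P - n₀ % P) % P, Nat.mod_lt _ hP, ?_⟩
  rw [rb_periodic_mod hper (n₀ + _), rb_periodic_mod hper n, Nat.add_mod_mod]
  congr 1
  have hr : n₀ % P < P := Nat.mod_lt _ hP
  have hdm : P * (n₀ / P) + n₀ % P = n₀ := Nat.div_add_mod n₀ P
  have heq : n₀ + (n + P - n₀ % P) = P * (n₀ / P + 1) + n := by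
    have := hdm
    generalize n₀ / P = q at this ⊢
    generalize n₀ % P = r at this hr ⊢
    subst this
    rw [Nat.mul_add, Nat.mul_one]
    omega
  rw [heq, Nat.mul_add_mod, Nat.mod_eq_of_lt hn]

/-- **A vertex with one outside neighbour carries one exterior dart**: two exterior darts at a
vertex of neighbour count one are equal. [folklore] -/
theorem rb_dart_unique {V : Finset (ℤ × ℤ)} {d d' : Dart}
    (hcard : ((neighbours d.1).filter (fun y ↦ y ∉ V)).card = 1) (h1 : d'.1 = d.1)
    (hd : dartTip d ∉ V) (hd' : dartTip d' ∉ V) : d = d' := by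
  obtain ⟨k, -, -, huniq⟩ := s3_outDart_of_card V d.1 hcard
  simp only [dartTip] at hd hd'
  rw [h1] at hd'
  exact Prod.ext h1.symm ((huniq _ hd).trans (huniq _ hd').symm)

/-- **Indices of row vertices are unique**: on an enumeration without repetition below `P`, two
indices below `P` whose darts sit at the same vertex of neighbour count one are equal. [folklore] -/
theorem rb_index_unique {V : Finset (ℤ × ℤ)} {e : ℕ → Dart} {P : ℕ}
    (hext : ∀ n, (e n).1 ∈ V ∧ dartTip (e n) ∉ V)
    (hnodup : ∀ n m, n < P → m < P → e n = e m → n = m) {i j : ℕ} (hi : i < P) (hj : j < P)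
    (hcard : ((neighbours (e i).1).filter (fun y ↦ y ∉ V)).card = 1) (h : (e j).1 = (e i).1) : i = j :=
  hnodup i j hi hj (rb_dart_unique hcard h (hext i).2 (hext j).2)

end Summit.CriticalPhenomena.CardyFormulaZ2.Cruxes.RectilinearCardy.ExcursionKernelCovariance

end
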